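/-
Copyright (c) 2026. All rights reserved.
Released under Apache 2.0 license as described in the file LICENSE.
-/
import Literature.Probability.FitznerVanDerHofstad2017.NoblePercLetters
import HarnessLib

/-!
# [FvdH17] §4.4 after (4.65): from a pointwise cover of the exact `N+1`-level event to the bound on its measure

Source: R. Fitzner, R. van der Hofstad, *Mean-field behavior for nearest-neighbor percolation in `d > 10`*,
Electron. J. Probab. **22** (2017) no. 43 [FvdH17] (arXiv:1506.07977v2), §4.4, the sentence after (4.65)
(p. 43): "Thus, we bound (3.31) by (4.65) summed over `t⃗`, `w⃗`, `z⃗`, each sum being estimated by a product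
of `ℙ^{b̲_{i-1}}`-probabilities since the levels are independent."

The module `NobleNestedXi` writes the coefficient `Ξ^{B,(n+1)}_p(v,x;A,A')` EXACTLY as
`Σ_b Π_i J(b_i) · ℙ_p^{⊗(n+2)}(nestXi n B A' A v b x)` (`nobleXiBT_succ_eq_tsum_pi_nestXi`).  The step
quoted above — cover the exact event, configuration by configuration, by a countable family of bounding
events and pass to measures — is typed here ONCE, generically, so that every joint-form bound
((4.65) for general `N`, its `ι`-twins (4.70)) is reduced to a purely combinatorial statement
"every tuple of LATTICE configurations in the exact event lies in some bounding event `W b k`":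

* `piPerc_setOf_exists_not_subset_edgeSet`: tuples with a non-lattice level are `ℙ_p^{⊗n}`-null, so covers
  need only be produced for configurations `ω i ⊆ E(ℤ^d)` (where open paths are lattice paths);
* `piPerc_le_tsum_of_cover` (+ two/three-index versions): `E ∩ {lattice} ⊆ ⋃_k W k ⇒ ℙ^{⊗n}(E) ≤ Σ_k ℙ^{⊗n}(W k)`;
* `tsum_mul_piPerc_le_of_cover`: the same under countably many weighted events `Σ_b c(b) ℙ^{⊗n}(E b)`
  (the shape `Σ_b Π_i J(b_i) ℙ^{⊗(n+2)}(nestXi …)` of `NobleNestedXi.nobleXiBT_succ_eq_tsum_pi_nestXi`), where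
  covers need only be produced for the parameters `b` with `c(b) ≠ 0` (for the bond weights: genuine bonds).

The specialisations to `Ξ^{B,(n+1)}`, `Ξ^{(M+2)}`, `Ξ^{(1)}` are then one `rw` with the exact formulas of
`NobleNestedXi` followed by `tsum_mul_piPerc_le_of_cover` (kept out of this file so that it depends on
`NoblePercLetters` only).

Kernel-checked measure theory over the tree's objects; no named fact, no numeral, no dimension fixed.
-/

namespace Literature.Probability.FitznerVanDerHofstad2017

open _root_.MeasureTheory Literature.Barriers.CriticalPhenomena Literature.Probability.Percolation
open Literature.Probability.LatticeModels _root_.SimpleGraph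
open Literature.Probability.FitznerVanDerHofstad2017.NobleBlocks (piPerc)
open scoped ENNReal

variable {d : ℕ}

/-! ## A. Non-lattice configurations are null on the product space -/

/-- Tuples of configurations one of whose levels uses a non-bond of `ℤ^d` form a `ℙ_p^{⊗n}`-null set.
[folklore] -/
theorem piPerc_setOf_exists_not_subset_edgeSet (p : unitInterval) (n : ℕ) :
    piPerc d p n {ω | ∃ i, ¬ ω i ⊆ (zdGraph d).edgeSet} = 0 := by
  have h : {ω : Fin n → BondConfig (Site d) | ∃ i, ¬ ω i ⊆ (zdGraph d).edgeSet} =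
      ⋃ i : Fin n, Function.eval i ⁻¹' {ω : BondConfig (Site d) | ¬ ω ⊆ (zdGraph d).edgeSet} := by
    ext ω
    simp only [Set.mem_setOf_eq, Set.mem_iUnion, Set.mem_preimage, Function.eval]
  rw [h]
  refine le_antisymm ((measure_iUnion_le _).trans (le_of_eq (ENNReal.tsum_eq_zero.2 fun i => ?_))) bot_le
  unfold piPerc
  exact Measure.pi_eval_preimage_null (fun _ : Fin n => bondPercolation (zdGraph d) p)
    (measure_not_subset_edgeSet p)

/-! ## B. Cover-to-measure -/

/-- **Cover-to-measure.**  If every tuple of LATTICE configurations in `E` lies in some `W k` (`k` ranging over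
a countable index type), then `ℙ_p^{⊗n}(E) ≤ Σ_k ℙ_p^{⊗n}(W k)`.
[cite: FitznerVanDerHofstad2017, §4.4 after (4.65) (arXiv:1506.07977v2 p. 43)] -/
theorem piPerc_le_tsum_of_cover (p : unitInterval) {n : ℕ} {ι : Type*} [Countable ι]
    (E : Set (Fin n → BondConfig (Site d))) (W : ι → Set (Fin n → BondConfig (Site d)))
    (h : ∀ ω ∈ E, (∀ i, ω i ⊆ (zdGraph d).edgeSet) → ∃ k, ω ∈ W k) :
    piPerc d p n E ≤ ∑' k, piPerc d p n (W k) := by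
  have hsub : E ⊆ (⋃ k, W k) ∪ {ω | ∃ i, ¬ ω i ⊆ (zdGraph d).edgeSet} := by
    intro ω hω
    by_cases hl : ∀ i, ω i ⊆ (zdGraph d).edgeSet
    · exact Or.inl (Set.mem_iUnion.2 (h ω hω hl))
    · exact Or.inr (by simpa only [Set.mem_setOf_eq, not_forall] using hl)
  calc piPerc d p n E
      ≤ piPerc d p n ((⋃ k, W k) ∪ {ω | ∃ i, ¬ ω i ⊆ (zdGraph d).edgeSet}) := measure_mono hsub
    _ ≤ piPerc d p n (⋃ k, W k) + piPerc d p n {ω | ∃ i, ¬ ω i ⊆ (zdGraph d).edgeSet} :=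
        measure_union_le _ _
    _ = piPerc d p n (⋃ k, W k) := by rw [piPerc_setOf_exists_not_subset_edgeSet, add_zero]
    _ ≤ ∑' k, piPerc d p n (W k) := measure_iUnion_le _

/-- Cover-to-measure with a two-parameter family of bounding events. [cite: FitznerVanDerHofstad2017, §4.4 after (4.65) (arXiv:1506.07977v2 p. 43)] -/
theorem piPerc_le_tsum_tsum_of_cover (p : unitInterval) {n : ℕ} {ι κ : Type*} [Countable ι] [Countable κ]
    (E : Set (Fin n → BondConfig (Site d))) (W : ι → κ → Set (Fin n → BondConfig (Site d)))
    (h : ∀ ω ∈ E, (∀ i, ω i ⊆ (zdGraph d).edgeSet) → ∃ k l, ω ∈ W k l) :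
    piPerc d p n E ≤ ∑' k, ∑' l, piPerc d p n (W k l) := by
  calc piPerc d p n E ≤ ∑' q : ι × κ, piPerc d p n (W q.1 q.2) :=
        piPerc_le_tsum_of_cover p E (fun q : ι × κ => W q.1 q.2) fun ω hω hl => by
          obtain ⟨k, l, hkl⟩ := h ω hω hl
          exact ⟨(k, l), hkl⟩
    _ = ∑' k, ∑' l, piPerc d p n (W k l) := ENNReal.tsum_prod'

/-- Cover-to-measure with a three-parameter family of bounding events (the shape of (4.65): `Σ_{t,w,z}`).
[cite: FitznerVanDerHofstad2017, (4.65) and §4.4 after (4.65) (arXiv:1506.07977v2 p. 43)] -/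
theorem piPerc_le_tsum_tsum_tsum_of_cover (p : unitInterval) {n : ℕ} {ι κ σ : Type*}
    [Countable ι] [Countable κ] [Countable σ]
    (E : Set (Fin n → BondConfig (Site d))) (W : ι → κ → σ → Set (Fin n → BondConfig (Site d)))
    (h : ∀ ω ∈ E, (∀ i, ω i ⊆ (zdGraph d).edgeSet) → ∃ k l m, ω ∈ W k l m) :
    piPerc d p n E ≤ ∑' k, ∑' l, ∑' m, piPerc d p n (W k l m) := by
  calc piPerc d p n E ≤ ∑' k, ∑' q : κ × σ, piPerc d p n (W k q.1 q.2) :=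
        piPerc_le_tsum_tsum_of_cover p E (fun k (q : κ × σ) => W k q.1 q.2) fun ω hω hl => by
          obtain ⟨k, l, m, hklm⟩ := h ω hω hl
          exact ⟨k, (l, m), hklm⟩
    _ = ∑' k, ∑' l, ∑' m, piPerc d p n (W k l m) := tsum_congr fun k => ENNReal.tsum_prod'

/-! ## C. Weighted families -/

/-- **Weighted cover-to-measure.**  `Σ_b c(b) ℙ^{⊗n}(E b) ≤ Σ_b Σ_k c(b) ℙ^{⊗n}(W b k)` as soon as, for every
parameter `b` satisfying a predicate `good` outside of which the weight `c` vanishes (for the bond weights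
`Π_i J(b_i)`: "every `b_i` is a bond of `ℤ^d`") and every tuple of lattice configurations `ω ∈ E b`, some
`W b k ∋ ω`.  [cite: FitznerVanDerHofstad2017, §4.4 after (4.65) (arXiv:1506.07977v2 p. 43)] -/
theorem tsum_mul_piPerc_le_of_cover (p : unitInterval) {n : ℕ} {β ι : Type*} [Countable ι]
    (c : β → ℝ≥0∞) (good : β → Prop) (hc : ∀ b, ¬ good b → c b = 0)
    (E : β → Set (Fin n → BondConfig (Site d))) (W : β → ι → Set (Fin n → BondConfig (Site d)))
    (h : ∀ b, good b → ∀ ω ∈ E b, (∀ i, ω i ⊆ (zdGraph d).edgeSet) → ∃ k, ω ∈ W b k) :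
    ∑' b, c b * piPerc d p n (E b) ≤ ∑' b, ∑' k, c b * piPerc d p n (W b k) := by
  refine ENNReal.tsum_le_tsum fun b => ?_
  by_cases hb : good b
  · rw [ENNReal.tsum_mul_left]
    exact mul_le_mul' le_rfl (piPerc_le_tsum_of_cover p (E b) (W b) (h b hb))
  · rw [hc b hb, zero_mul]
    exact zero_le

/-- Weighted cover-to-measure, three-parameter bounding families (the shape `Σ_b Π J(b_i) Σ_{t,w,z}` of (4.65)).
[cite: FitznerVanDerHofstad2017, (4.65) and §4.4 after (4.65) (arXiv:1506.07977v2 p. 43)] -/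
theorem tsum_mul_piPerc_le_of_cover₃ (p : unitInterval) {n : ℕ} {β ι κ σ : Type*}
    [Countable ι] [Countable κ] [Countable σ]
    (c : β → ℝ≥0∞) (good : β → Prop) (hc : ∀ b, ¬ good b → c b = 0)
    (E : β → Set (Fin n → BondConfig (Site d))) (W : β → ι → κ → σ → Set (Fin n → BondConfig (Site d)))
    (h : ∀ b, good b → ∀ ω ∈ E b, (∀ i, ω i ⊆ (zdGraph d).edgeSet) → ∃ k l m, ω ∈ W b k l m) :
    ∑' b, c b * piPerc d p n (E b) ≤ ∑' b, ∑' k, ∑' l, ∑' m, c b * piPerc d p n (W b k l m) := by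
  refine ENNReal.tsum_le_tsum fun b => ?_
  by_cases hb : good b
  · simp_rw [ENNReal.tsum_mul_left]
    exact mul_le_mul' le_rfl (piPerc_le_tsum_tsum_tsum_of_cover p (E b) (W b) (h b hb))
  · simp_rw [hc b hb, zero_mul, tsum_zero]
    exact le_rfl

/-- The vanishing condition for the bond weight: `J(v - u) = 0` (in `[0,∞]`) unless `v - u ∼ 0`. [folklore] -/
theorem ofReal_bondJ_eq_zero_of_not_adj' (p : unitInterval) {y : Site d} (h : ¬ (zdGraph d).Adj 0 y) :
    ENNReal.ofReal (bondJ d p y) = 0 := by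
  rw [bondJ_def, if_neg h, ENNReal.ofReal_zero]

/-- The vanishing condition for a finite product of bond weights `Π_i J(b_i)`. [folklore] -/
theorem prod_ofReal_bondJ_eq_zero_of_not_adj (p : unitInterval) {m : ℕ} {b : Fin m → Site d × Site d}
    (h : ¬ ∀ i, (zdGraph d).Adj 0 ((b i).2 - (b i).1)) :
    ∏ i, ENNReal.ofReal (bondJ d p ((b i).2 - (b i).1)) = 0 := by
  obtain ⟨i, hi⟩ := not_forall.1 h
  exact Finset.prod_eq_zero (Finset.mem_univ i) (ofReal_bondJ_eq_zero_of_not_adj' p hi)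

end Literature.Probability.FitznerVanDerHofstad2017
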